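import Summits.QuantumFields.YangMills.Theorems.AlphaInputsT3ACv3TubeLetters
import Summits.QuantumFields.YangMills.Theorems.AlphaInputsT3ACv3ModelBox
import HarnessLib

/-!
# `AlphaInputsT3ACv3TubeFieldModel` — START v3 for the (FL) `hLift` binder, row (S2) on the MODEL BOX: **THE TUBE FIELD AROUND AN EDGE** — four quadrant cells `Q₁ = {u_μ ≤ 0, u_ν ≤ 0}`,
# `Q₂ = {u_μ ≥ 1, u_ν ≤ 0}`, `Q₃ = {u_μ ≥ 1, u_ν ≥ 1}`, `Q₄ = {u_μ ≤ 0, u_ν ≥ 1}` of `ℤ^d` around the edge `{u_μ = u_ν = ½}`, face values `V₁₂, V₂₃, V₄₃, V₁₄ ∈ SU(n)`, the block frame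
# `G = (1, V₁₂, V₁₂V₂₃, V₁₄)` trivialising three faces, the string face `4|3` carrying `e^{F′} = V₁₄V₄₃V₂₃⁻¹V₁₂⁻¹`; for ANY real transverse form `t` the field
# `U_t(u,κ) = G(u)⁻¹·expSU(t(u,κ)F′)·G(u+e_κ)` has ★★ `plaqB U_t (u;α,β) = G(u)⁻¹·expSU((curlB t)(u;α,β)F′)·G(u)` EXACTLY, and ★★ `U_s =` the model SECTION for `s` = the string indicator —
# lane `pub-balaban3d` ∕ cell `ym3-torus`, seat `ym-ust-19936-w1` (g2, LEAD)

WHY (memo v3 `HOME/ym-ust-19936-w1/NONABELIAN-FL-START-w1-g2.md` §3 (T); OWNER RULING 19936 (FL) START 02:16:33Z, row (S2) → LEAD).  The START of record is the section `iterSec k V` with its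
corner lines smoothed in place.  Around one interior edge, in block coordinates, the section is the MODEL SECTION `W` below (face values on the bonds crossing the four half-faces, `1`
elsewhere); the tube replaces `W = U_s` by `U_{s−β}` with ★w2 g2's universal profile `β` ((S1) `…TubeProfile`: `curl β = δ_corner − ρ`), and by `plaqB_tubeU` the plaquettes of `U_{s−β}`
are EXACTLY `G⁻¹·expSU(curlB(s−β)·F′)·G` — i.e. `expSU(−ρ·F′)`-conjugates inside the square (`curlB s = −δ_corner`, `curlB_stringInd`), `1` on every plaquette containing a longitudinal
direction (`curlB` of a transverse, longitudinally constant form vanishes there, `curlB_eq_zero_of_longitudinal`), and `U_{s−β} = W` wherever `β = 0` (`tubeU_congr`).  No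
Baker–Campbell–Hausdorff remainder anywhere: every bond variable of `U_t` is `G⁻¹·exp(ℝF′)·G`.
WHAT IS HERE (defs on the model box only; torus chart = row (S5)): `quadG` (the frame), `modelSec` (the section), `stringInd` (the indicator of the `4|3` crossing bonds), `tubeU t`;
★★ `modelSec_eq_tubeU_stringInd` (case analysis over the four quadrants and the bond direction), ★★ `plaqB_tubeU`, ★ `dist1_plaqB_tubeU_le` (`≤ e^{|curlB t|·‖F′‖} − 1`),
`plaqB_tubeU_eq_one` (when `curlB t = 0`), `curlB_stringInd` (`= −[u_μ = 0 ∧ u_ν = 0]` on transverse plaquettes), `curlB_eq_zero_of_longitudinal`, `tubeU_congr`.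
HONEST FRAMING.  Finite group algebra on `ℤ^d`; the profile `β` (S1), the boundary gauge (S3), the transfinite fill (S4), the chart + region bookkeeping (S5) and the defect (S6) are
NOT here; (FL)∕`hLift` NOT proved; count-neutral helper toward R3 2′ (items 19936∕19935); registry untouched; nothing about d = 4, the continuum, or a mass gap; YM₃ on T³ is rung R3,
not Clay.

References: T. Bałaban, Commun. Math. Phys. 102 (1985) 277–309 [Balaban1985Variational] ((11)–(14) pp.279–280: the section of a coarse field); Commun. Math. Phys. 98 (1985) 17–51
[Balaban1985Averaging] ((8)–(9) pp.18–19, (12) p.19); W. Rossmann, Lie Groups (2002) [Rossmann2002] (§1.1).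
-/

set_option autoImplicit false

noncomputable section

open scoped Matrix.Norms.L2Operator

namespace Summit.QuantumFields.YangMills.Theorems.TubeStart

open Literature.MathematicalPhysics.QuantumFieldTheory.Balaban1983to89
open Literature.MathematicalPhysics.QuantumFieldTheory.Balaban1983to89.T4AdjointCovarianceUnitary (lieSU expSU coe_expSU)
open Summit.QuantumFields.YangMills.Theorems.ModelBox

variable {d : ℕ} {n : Type*} [Fintype n] [DecidableEq n]

/-! ## §1 The four quadrants, the block frame, the model section, the string -/

section Defs

variable (μ ν : Fin d) (V₁₂ V₂₃ V₄₃ V₁₄ : Matrix.specialUnitaryGroup n ℂ)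

/-- **THE BLOCK FRAME** trivialising the faces `1|2`, `2|3`, `1|4`: `G = 1` on `Q₁ = {u_μ ≤ 0, u_ν ≤ 0}`, `V₁₄` on `Q₄ = {u_μ ≤ 0, u_ν ≥ 1}`, `V₁₂` on `Q₂ = {u_μ ≥ 1, u_ν ≤ 0}`,
`V₁₂V₂₃` on `Q₃ = {u_μ ≥ 1, u_ν ≥ 1}`. [cite: Balaban1985Averaging, (8) p.19] -/
def quadG (u : Fin d → ℤ) : Matrix.specialUnitaryGroup n ℂ :=
  if u μ ≤ 0 then (if u ν ≤ 0 then 1 else V₁₄) else (if u ν ≤ 0 then V₁₂ else V₁₂ * V₂₃)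

/-- **THE MODEL SECTION** around the edge: the face value on every bond crossing one of the four half-faces (`u_μ = 0 → 1`: `V₁₂` below ∕ `V₄₃` above the edge; `u_ν = 0 → 1`: `V₁₄`
left ∕ `V₂₃` right of the edge), `1` on every other bond — `iterSec k V` read in the chart of row (S5). [cite: Balaban1985Variational, (11) p.279] -/
def modelSec (u : Fin d → ℤ) (κ : Fin d) : Matrix.specialUnitaryGroup n ℂ :=
  if κ = μ ∧ u μ = 0 then (if u ν ≤ 0 then V₁₂ else V₄₃)
  else if κ = ν ∧ u ν = 0 then (if u μ ≤ 0 then V₁₄ else V₂₃) else 1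

/-- **THE STRING**: indicator of the bonds crossing the face `4|3` (`μ`-bonds from `u_μ = 0` with `u_ν ≥ 1`). [folklore] -/
def stringInd (u : Fin d → ℤ) (κ : Fin d) : ℝ := if κ = μ ∧ u μ = 0 ∧ 1 ≤ u ν then 1 else 0

/-- **THE TUBE FIELD WITH TRANSVERSE FORM `t`**: `U_t(u,κ) = G(u)⁻¹·expSU(t(u,κ)·F′)·G(u+e_κ)`. [cite: Balaban1985Averaging, (8) p.19] -/
def tubeU (F' : lieSU n) (t : (Fin d → ℤ) → Fin d → ℝ) (u : Fin d → ℤ) (κ : Fin d) : Matrix.specialUnitaryGroup n ℂ :=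
  (quadG μ ν V₁₂ V₂₃ V₁₄ u)⁻¹ * expSU (t u κ • F') * quadG μ ν V₁₂ V₂₃ V₁₄ (u + e κ)

end Defs

/-! ## §2 The tube field is a framed one-parameter field: exact plaquettes -/

section Plaquettes

variable (μ ν : Fin d) (V₁₂ V₂₃ V₄₃ V₁₄ : Matrix.specialUnitaryGroup n ℂ) (F' : lieSU n)

/-- `U_t` is the model gauge transform by `G⁻¹` of the one-parameter field `expSU(t·F′)`. [cite: Balaban1985Averaging, (8) p.19] -/
theorem tubeU_eq_gaugeB (t : (Fin d → ℤ) → Fin d → ℝ) :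
    tubeU μ ν V₁₂ V₂₃ V₁₄ F' t = gaugeB (fun u => (quadG μ ν V₁₂ V₂₃ V₁₄ u)⁻¹) (fun u κ => expSU (t u κ • F')) := by
  funext u κ
  rw [tubeU, gaugeB_def, inv_inv]

/-- **★★ THE PLAQUETTES OF THE TUBE FIELD, EXACTLY**: `plaqB U_t (u; α, β) = G(u)⁻¹·expSU((curlB t)(u;α,β)·F′)·G(u)` for EVERY plaquette direction pair — no commutator remainder.
[cite: Balaban1985Averaging, (9)+(12) p.19; Rossmann2002, §1.1] -/
theorem plaqB_tubeU (t : (Fin d → ℤ) → Fin d → ℝ) (u : Fin d → ℤ) (α β : Fin d) :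
    plaqB (tubeU μ ν V₁₂ V₂₃ V₁₄ F' t) u α β =
      (quadG μ ν V₁₂ V₂₃ V₁₄ u)⁻¹ * expSU (curlB t u α β • F') * quadG μ ν V₁₂ V₂₃ V₁₄ u := by
  rw [tubeU_eq_gaugeB, plaqB_gaugeB, inv_inv, plaqB_def, expSU_plaq_word, curlB_def]

/-- **★ HENCE `dist1 (U_t(∂p)) ≤ e^{|curlB t(p)|·‖F′‖} − 1`.** [cite: Balaban1985Averaging, (12) p.19, (19) p.21] -/
theorem dist1_plaqB_tubeU_le [Nonempty n] (t : (Fin d → ℤ) → Fin d → ℝ) (u : Fin d → ℤ) (α β : Fin d) :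
    GaugeGroup.dist1 (plaqB (tubeU μ ν V₁₂ V₂₃ V₁₄ F' t) u α β) ≤ Real.exp (|curlB t u α β| * ‖(F' : Matrix n n ℂ)‖) - 1 := by
  rw [plaqB_tubeU]
  have hconj : GaugeGroup.dist1 ((quadG μ ν V₁₂ V₂₃ V₁₄ u)⁻¹ * expSU (curlB t u α β • F') * quadG μ ν V₁₂ V₂₃ V₁₄ u) =
      GaugeGroup.dist1 (expSU (curlB t u α β • F')) := by
    have := GaugeGroup.dist1_conj (expSU (curlB t u α β • F')) (quadG μ ν V₁₂ V₂₃ V₁₄ u)⁻¹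
    rwa [inv_inv] at this
  rw [hconj]
  refine (dist1_expSU_le _).trans (le_of_eq ?_)
  rw [Submodule.coe_smul, norm_smul, Real.norm_eq_abs]

/-- **PLAQUETTES WITH VANISHING `curlB t` ARE TRIVIAL** (longitudinal plaquettes of a longitudinally constant transverse form; transverse plaquettes off the support of `ρ`).
[cite: Balaban1985Averaging, (12) p.19] -/
theorem plaqB_tubeU_eq_one (t : (Fin d → ℤ) → Fin d → ℝ) (u : Fin d → ℤ) (α β : Fin d) (h : curlB t u α β = 0) :
    plaqB (tubeU μ ν V₁₂ V₂₃ V₁₄ F' t) u α β = 1 := by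
  rw [plaqB_tubeU, h, zero_smul, expSU_zero', mul_one, inv_mul_cancel]

/-- Tube fields with pointwise equal forms agree on that bond (so `U_{s−β} = U_s =` the section wherever `β = 0`). [folklore] -/
theorem tubeU_congr {t t' : (Fin d → ℤ) → Fin d → ℝ} {u : Fin d → ℤ} {κ : Fin d} (h : t u κ = t' u κ) :
    tubeU μ ν V₁₂ V₂₃ V₁₄ F' t u κ = tubeU μ ν V₁₂ V₂₃ V₁₄ F' t' u κ := by
  rw [tubeU, tubeU, h]

end Plaquettes

/-! ## §3 Curl bookkeeping: the string and longitudinal invariance -/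

section Curl

variable (μ ν : Fin d)

/-- The string on a `μ`-bond: `1` iff `u_μ = 0 ∧ 1 ≤ u_ν`. [folklore] -/
theorem stringInd_self (u : Fin d → ℤ) : stringInd μ ν u μ = if u μ = 0 ∧ 1 ≤ u ν then 1 else 0 := by
  simp [stringInd]

/-- The string vanishes on every bond that is not a `μ`-bond. [folklore] -/
theorem stringInd_of_ne {κ : Fin d} (hκ : κ ≠ μ) (u : Fin d → ℤ) : stringInd μ ν u κ = 0 := by
  simp [stringInd, hκ]

/-- **THE CURL OF THE STRING IS MINUS THE CORNER**: on the transverse plaquette `(u; μ, ν)`, `curlB s = −[u_μ = 0 ∧ u_ν = 0]`. [folklore] -/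
theorem curlB_stringInd (hμν : μ ≠ ν) (u : Fin d → ℤ) :
    curlB (stringInd μ ν) u μ ν = if u μ = 0 ∧ u ν = 0 then -1 else 0 := by
  have hνμ : ν ≠ μ := fun h => hμν h.symm
  rw [curlB_def, stringInd_of_ne μ ν hνμ, stringInd_of_ne μ ν hνμ, stringInd_self, stringInd_self,
    add_e_apply_ne _ hμν, add_e_apply_same]
  by_cases h0 : u μ = 0
  · by_cases h1 : 1 ≤ u ν
    · rw [if_pos ⟨h0, h1⟩, if_pos ⟨h0, by omega⟩, if_neg (by omega)]; ring
    · by_cases h2 : u ν = 0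
      · rw [if_neg (by omega), if_pos ⟨h0, by omega⟩, if_pos ⟨h0, h2⟩]; ring
      · rw [if_neg (by omega), if_neg (by omega), if_neg (by omega)]; ring
  · rw [if_neg (by omega), if_neg (by omega), if_neg (by omega)]; ring

/-- **LONGITUDINAL PLAQUETTES SEE NO CURL**: if `t` vanishes on `κ`-bonds and is invariant under `u ↦ u + e_κ`, then `curlB t (u; α, κ) = 0` and `curlB t (u; κ, α) = 0`.
[folklore] -/
theorem curlB_eq_zero_of_longitudinal (t : (Fin d → ℤ) → Fin d → ℝ) (κ : Fin d) (hκ : ∀ u, t u κ = 0) (hinv : ∀ u α, t (u + e κ) α = t u α)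
    (u : Fin d → ℤ) (α : Fin d) : curlB t u α κ = 0 ∧ curlB t u κ α = 0 := by
  refine ⟨?_, ?_⟩
  · rw [curlB_def, hκ, hκ, hinv]; ring
  · rw [curlB_def, hκ, hκ, hinv]; ring

/-- The string is invariant under longitudinal translations (`κ ∉ {μ, ν}`). [folklore] -/
theorem stringInd_add_e_of_ne {κ : Fin d} (hκμ : κ ≠ μ) (hκν : κ ≠ ν) (u : Fin d → ℤ) (α : Fin d) :
    stringInd μ ν (u + e κ) α = stringInd μ ν u α := by
  simp only [stringInd, add_e_apply_ne _ hκμ.symm, add_e_apply_ne _ hκν.symm]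

end Curl

/-! ## §4 The section IS the tube field with the string as its form -/

section Section

variable (μ ν : Fin d) (V₁₂ V₂₃ V₄₃ V₁₄ : Matrix.specialUnitaryGroup n ℂ) (F' : lieSU n)

/-- The frame does not change along a bond that is not a `μ`- or `ν`-bond. [folklore] -/
theorem quadG_add_e_of_ne {κ : Fin d} (hκμ : κ ≠ μ) (hκν : κ ≠ ν) (u : Fin d → ℤ) :
    quadG μ ν V₁₂ V₂₃ V₁₄ (u + e κ) = quadG μ ν V₁₂ V₂₃ V₁₄ u := by
  simp only [quadG, add_e_apply_ne _ hκμ.symm, add_e_apply_ne _ hκν.symm]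

/-- The frame on `Q₁`. [folklore] -/
theorem quadG_Q₁ {u : Fin d → ℤ} (h1 : u μ ≤ 0) (h2 : u ν ≤ 0) : quadG μ ν V₁₂ V₂₃ V₁₄ u = 1 := by simp [quadG, h1, h2]

/-- The frame on `Q₄`. [folklore] -/
theorem quadG_Q₄ {u : Fin d → ℤ} (h1 : u μ ≤ 0) (h2 : ¬ u ν ≤ 0) : quadG μ ν V₁₂ V₂₃ V₁₄ u = V₁₄ := by simp [quadG, h1, h2]

/-- The frame on `Q₂`. [folklore] -/
theorem quadG_Q₂ {u : Fin d → ℤ} (h1 : ¬ u μ ≤ 0) (h2 : u ν ≤ 0) : quadG μ ν V₁₂ V₂₃ V₁₄ u = V₁₂ := by simp [quadG, h1, h2]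

/-- The frame on `Q₃`. [folklore] -/
theorem quadG_Q₃ {u : Fin d → ℤ} (h1 : ¬ u μ ≤ 0) (h2 : ¬ u ν ≤ 0) : quadG μ ν V₁₂ V₂₃ V₁₄ u = V₁₂ * V₂₃ := by simp [quadG, h1, h2]

/-- The frame depends only on the two signs (`u_μ ≤ 0`, `u_ν ≤ 0`). [folklore] -/
theorem quadG_congr {u v : Fin d → ℤ} (h1 : (u μ ≤ 0 ↔ v μ ≤ 0)) (h2 : (u ν ≤ 0 ↔ v ν ≤ 0)) :
    quadG μ ν V₁₂ V₂₃ V₁₄ u = quadG μ ν V₁₂ V₂₃ V₁₄ v := by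
  simp only [quadG, h1, h2]

/-- The section on a longitudinal bond. [cite: Balaban1985Variational, (11) p.279] -/
theorem modelSec_of_ne {κ : Fin d} (hκμ : κ ≠ μ) (hκν : κ ≠ ν) (u : Fin d → ℤ) : modelSec μ ν V₁₂ V₂₃ V₄₃ V₁₄ u κ = 1 := by
  simp [modelSec, hκμ, hκν]

/-- The section on a `μ`-bond. [cite: Balaban1985Variational, (11) p.279] -/
theorem modelSec_μ (hμν : μ ≠ ν) (u : Fin d → ℤ) :
    modelSec μ ν V₁₂ V₂₃ V₄₃ V₁₄ u μ = if u μ = 0 then (if u ν ≤ 0 then V₁₂ else V₄₃) else 1 := by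
  by_cases h0 : u μ = 0 <;> simp [modelSec, h0, hμν]

/-- The section on a `ν`-bond. [cite: Balaban1985Variational, (11) p.279] -/
theorem modelSec_ν (hμν : μ ≠ ν) (u : Fin d → ℤ) :
    modelSec μ ν V₁₂ V₂₃ V₄₃ V₁₄ u ν = if u ν = 0 then (if u μ ≤ 0 then V₁₄ else V₂₃) else 1 := by
  have hνμ : ν ≠ μ := fun h => hμν h.symm
  by_cases h0 : u ν = 0 <;> simp [modelSec, h0, hνμ]

/-- **★★ THE MODEL SECTION IS THE FRAMED ONE-PARAMETER FIELD OF THE STRING**: `W = U_s`, provided `expSU F′ = V₁₄V₄₃V₂₃⁻¹V₁₂⁻¹` (the holonomy of the coarse plaquette read from cell 4 through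
the frame) and `μ ≠ ν`. [cite: Balaban1985Variational, (11) p.279; Balaban1985Averaging, (8) p.19] -/
theorem modelSec_eq_tubeU_stringInd (hμν : μ ≠ ν) (hF : expSU F' = V₁₄ * V₄₃ * V₂₃⁻¹ * V₁₂⁻¹) (u : Fin d → ℤ) (κ : Fin d) :
    modelSec μ ν V₁₂ V₂₃ V₄₃ V₁₄ u κ = tubeU μ ν V₁₂ V₂₃ V₁₄ F' (stringInd μ ν) u κ := by
  have hνμ : ν ≠ μ := fun h => hμν h.symm
  rw [tubeU]
  by_cases hκμ : κ = μ
  · subst hκμ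
    -- a `μ`-bond: the `ν`-coordinate is unchanged along it
    rw [modelSec_μ κ ν V₁₂ V₂₃ V₄₃ V₁₄ hμν, stringInd_self]
    have hν' : (u + e κ) ν = u ν := add_e_apply_ne _ hνμ
    by_cases h0 : u κ = 0
    · have hu : u κ ≤ 0 := by omega
      have hu' : ¬ (u + e κ) κ ≤ 0 := by rw [add_e_apply_same]; omega
      by_cases hν : u ν ≤ 0
      · rw [if_pos h0, if_pos hν, if_neg (by omega), zero_smul, expSU_zero', mul_one,
          quadG_Q₁ κ ν V₁₂ V₂₃ V₁₄ hu hν, quadG_Q₂ κ ν V₁₂ V₂₃ V₁₄ hu' (by rw [hν']; exact hν), inv_one, one_mul]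
      · rw [if_pos h0, if_neg hν, if_pos ⟨h0, by omega⟩, one_smul, hF,
          quadG_Q₄ κ ν V₁₂ V₂₃ V₁₄ hu hν, quadG_Q₃ κ ν V₁₂ V₂₃ V₁₄ hu' (by rw [hν']; exact hν)]
        group
    · rw [if_neg h0, if_neg (fun h => h0 h.1), zero_smul, expSU_zero', mul_one]
      have hsame : quadG κ ν V₁₂ V₂₃ V₁₄ (u + e κ) = quadG κ ν V₁₂ V₂₃ V₁₄ u :=
        quadG_congr κ ν V₁₂ V₂₃ V₁₄ (by rw [add_e_apply_same]; omega) (by rw [hν'])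
      rw [hsame, inv_mul_cancel]
  · rw [stringInd_of_ne μ ν hκμ, zero_smul, expSU_zero', mul_one]
    by_cases hκν : κ = ν
    · subst hκν
      -- a `ν`-bond: the `μ`-coordinate is unchanged along it
      rw [modelSec_ν μ κ V₁₂ V₂₃ V₄₃ V₁₄ hμν]
      have hμ' : (u + e κ) μ = u μ := add_e_apply_ne _ hμν
      by_cases h0 : u κ = 0
      · have hu : u κ ≤ 0 := by omega
        have hu' : ¬ (u + e κ) κ ≤ 0 := by rw [add_e_apply_same]; omega
        by_cases hμ : u μ ≤ 0
        · rw [if_pos h0, if_pos hμ, quadG_Q₁ μ κ V₁₂ V₂₃ V₁₄ hμ hu, quadG_Q₄ μ κ V₁₂ V₂₃ V₁₄ (by rw [hμ']; exact hμ) hu', inv_one, one_mul]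
        · rw [if_pos h0, if_neg hμ, quadG_Q₂ μ κ V₁₂ V₂₃ V₁₄ hμ hu, quadG_Q₃ μ κ V₁₂ V₂₃ V₁₄ (by rw [hμ']; exact hμ) hu']
          group
      · rw [if_neg h0]
        have hsame : quadG μ κ V₁₂ V₂₃ V₁₄ (u + e κ) = quadG μ κ V₁₂ V₂₃ V₁₄ u :=
          quadG_congr μ κ V₁₂ V₂₃ V₁₄ (by rw [hμ']) (by rw [add_e_apply_same]; omega)
        rw [hsame, inv_mul_cancel]
    · -- a longitudinal bond: the frame is constant along it and the section is `1`
      rw [modelSec_of_ne μ ν V₁₂ V₂₃ V₄₃ V₁₄ hκμ hκν, quadG_add_e_of_ne μ ν V₁₂ V₂₃ V₁₄ hκμ hκν, inv_mul_cancel]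

/-- **COROLLARY: off the string-modified bonds the tube is the section** — if `t` agrees with the string indicator at `(u, κ)` then `U_t(u,κ) = W(u,κ)`.
[cite: Balaban1985Variational, (11) p.279] -/
theorem tubeU_eq_modelSec_of_eq (hμν : μ ≠ ν) (hF : expSU F' = V₁₄ * V₄₃ * V₂₃⁻¹ * V₁₂⁻¹) {t : (Fin d → ℤ) → Fin d → ℝ}
    {u : Fin d → ℤ} {κ : Fin d} (h : t u κ = stringInd μ ν u κ) :
    tubeU μ ν V₁₂ V₂₃ V₁₄ F' t u κ = modelSec μ ν V₁₂ V₂₃ V₄₃ V₁₄ u κ := by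
  rw [modelSec_eq_tubeU_stringInd μ ν V₁₂ V₂₃ V₄₃ V₁₄ F' hμν hF, tubeU_congr μ ν V₁₂ V₂₃ V₁₄ F' h]

/-- **THE SECTION'S OWN PLAQUETTES, EXACTLY** (a by-product): `W(∂(u;μ,ν)) = G(u)⁻¹·expSU(−[u_μ = u_ν = 0]·F′)·G(u)` — the corner plaquette carries the whole coarse holonomy, every other
transverse plaquette is trivial. [cite: Balaban1985Variational, (11) p.279] -/
theorem plaqB_modelSec (hμν : μ ≠ ν) (hF : expSU F' = V₁₄ * V₄₃ * V₂₃⁻¹ * V₁₂⁻¹) (u : Fin d → ℤ) :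
    plaqB (modelSec μ ν V₁₂ V₂₃ V₄₃ V₁₄) u μ ν =
      (quadG μ ν V₁₂ V₂₃ V₁₄ u)⁻¹ * expSU ((if u μ = 0 ∧ u ν = 0 then (-1 : ℝ) else 0) • F') * quadG μ ν V₁₂ V₂₃ V₁₄ u := by
  have hW : modelSec μ ν V₁₂ V₂₃ V₄₃ V₁₄ = tubeU μ ν V₁₂ V₂₃ V₁₄ F' (stringInd μ ν) := by
    funext u κ; exact modelSec_eq_tubeU_stringInd μ ν V₁₂ V₂₃ V₄₃ V₁₄ F' hμν hF u κ
  rw [hW, plaqB_tubeU, curlB_stringInd μ ν hμν]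

end Section

end Summit.QuantumFields.YangMills.Theorems.TubeStart

end
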